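import Literature.Computability.AlgebraicComplexity.DeterminantalComplexity
import Literature.NumberTheory.DiophantineGeometry.DetOrbitSymKroneckerBound

/-!
# Sanity lemmas for `IsAffineDetRepr` / `HasDetRepr` and `IsDetSymStab` (pub-gct REVIEW-RUNBOOK-TREE)

Review evidence only (ops-runbook sanity registry `registry/pub-gct.json`); no new definitions.

* `IsAffineDetRepr f A` (entries of total degree `≤ 1`, `det A = f`;
  `Literature/Computability/AlgebraicComplexity/DeterminantalComplexity.lean`):
  holds — `x = det (x)` (size 1), `x₀x₃ − x₁x₂ = det (x₀ x₁; x₂ x₃)` (size 2); hence `HasDetRepr x 1`,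
  `HasDetRepr (x₀x₃ − x₁x₂) 2`; fails — the entry `x²` has degree 2 (degree clause), `det (0) ≠ x`
  (determinant clause): both clauses of the conjunction bite.
* `IsDetSymStab k m h` (`Literature/NumberTheory/DiophantineGeometry/DetOrbitSymKroneckerBound.lean`):
  the transposition `swapGL` belongs to the stabilising family (the family is non-empty).
-/

namespace Summit.PneNP.GCT.Runbook

open MvPolynomial Literature.Computability.AlgebraicComplexity

/-! ## `IsAffineDetRepr`: holds-instances -/

/-- Size 1: the variable `x` is the determinant of the `1 × 1` matrix `(x)` of affine linear forms. -/
theorem isAffineDetRepr_X : IsAffineDetRepr (X 0 : MvPolynomial (Fin 1) ℚ) !![X 0] := by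
  refine ⟨fun i j => ?_, ?_⟩
  · fin_cases i; fin_cases j
    simp [totalDegree_X]
  · simp

/-- Size 2: the `2 × 2` determinant polynomial `x₀x₃ − x₁x₂` is the determinant of the generic matrix
`(x₀ x₁; x₂ x₃)`, whose entries are linear. -/
theorem isAffineDetRepr_det_two :
    IsAffineDetRepr (X 0 * X 3 - X 1 * X 2 : MvPolynomial (Fin 4) ℚ) !![X 0, X 1; X 2, X 3] := by
  refine ⟨fun i j => ?_, ?_⟩
  · fin_cases i <;> fin_cases j <;> simp [totalDegree_X]
  · simp [Matrix.det_fin_two]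

/-- Hence `x` has an affine determinantal representation of size `1` (`dc(x) ≤ 1`). -/
theorem hasDetRepr_X_one : HasDetRepr (X 0 : MvPolynomial (Fin 1) ℚ) 1 :=
  ⟨!![X 0], isAffineDetRepr_X⟩

/-- Hence `x₀x₃ − x₁x₂` has an affine determinantal representation of size `2`. -/
theorem hasDetRepr_det_two : HasDetRepr (X 0 * X 3 - X 1 * X 2 : MvPolynomial (Fin 4) ℚ) 2 :=
  ⟨!![X 0, X 1; X 2, X 3], isAffineDetRepr_det_two⟩

/-! ## `IsAffineDetRepr`: fails-instances (each clause bites) -/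

/-- Fails (degree clause): `(x²)` has the right determinant `x²` but its entry is NOT affine linear. -/
theorem not_isAffineDetRepr_sq :
    ¬ IsAffineDetRepr (X 0 ^ 2 : MvPolynomial (Fin 1) ℚ) !![X 0 ^ 2] := by
  rintro ⟨hdeg, -⟩
  have h := hdeg 0 0
  simp [totalDegree_X_pow] at h

/-- Fails (determinant clause): the zero `1 × 1` matrix has affine entries but determinant `0 ≠ x`. -/
theorem not_isAffineDetRepr_zero_matrix :
    ¬ IsAffineDetRepr (X 0 : MvPolynomial (Fin 1) ℚ) (0 : Matrix (Fin 1) (Fin 1) (MvPolynomial (Fin 1) ℚ)) := by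
  rintro ⟨-, hdet⟩
  rw [Matrix.det_fin_one, Matrix.zero_apply] at hdet
  exact X_ne_zero (R := ℚ) (0 : Fin 1) hdet.symm

/-! ## `IsDetSymStab`: the family is non-empty -/

open Literature.NumberTheory.DiophantineGeometry in
/-- The transposition `swapGL k m` (`X ↦ Xᵀ` on `k^{m²}`) is a member of the stabilising family
`IsDetSymStab k m` (second disjunct). -/
theorem isDetSymStab_swapGL (k : Type*) [Field k] (m : ℕ) : IsDetSymStab k m (swapGL k m) :=
  Or.inr rfl

end Summit.PneNP.GCT.Runbook
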